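import Literature.Topology.FourManifolds.GluckTwistHomology
import Literature.Topology.FourManifolds.CircleSurgeryExistence
import Literature.Topology.FourManifolds.GluingUniqueness
import Mathlib.Analysis.Convex.Contractible
import Mathlib.Analysis.Normed.Module.Ball.Homeomorph
import Mathlib.Topology.Instances.AddCircle.Real
import HarnessLib

/-!
# `H₂` of a Cappell–Shaneson sphere vanishes: reduction to Mayer–Vietoris (C–S 1976, §2)

Sibling file of `CappellShaneson.lean` / `CappellShanesonHomotopySphere.lean` in the decomposition
(D-0014 provefact, XL) of the named fact
`Literature.Topology.FourManifolds.nonempty_homotopyEquiv_sphere_four_of_isCappellShanesonSphere` (every Cappell–Shaneson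
sphere is homotopy equivalent to `S⁴`; Cappell–Shaneson, *Some new four-manifolds*, Ann. of Math.
104 (1976), §2). That fact is assembled from three leaves: simple connectivity, **`H₂(X; ℤ) = 0`**,
and the recognition of homotopy 4-spheres `spc4.S10`. Here the `H₂` leaf is **proved at universe
`0`** (where the mapping tori of `Literature.Topology.FourManifolds.IsCappellShanesonSphereOf` live, and to which the
universe-polymorphic fact reduces) from textbook named facts about singular homology and **one
new, smaller named fact**:

* the named facts of `Literature.AlgebraicTopology.SingularHomology.ExcisionMayerVietoris`
  (excision `relativeSingularHomology.isIso_map_of_interior_union_interior`, Hatcher Thm. 2.20;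
  Mayer–Vietoris exactness `mayerVietoris.exact₂`, Hatcher §2.2; the homology of spheres
  `isZero_singularHomology_sphere`, Hatcher Cor. 2.14), with `ℤ` coefficients, as hypotheses;
* the new named fact `Literature.Topology.FourManifolds.isZero_singularHomology_two_mappingTorus_compl_sectionCircle`:
  `H₂(T_A ∖ C; ℤ) = 0` for the mapping torus `T_A` of `A ∈ SL(3, ℤ)`, `det (A - 1) = ±1`, minus its
  section circle `C` (Cappell–Shaneson 1976, §2: the Wang sequence of the `T³ ∖ pt`-bundle `T_A ∖ C`
  with `A - 1` and `Λ²A - 1` invertible).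

## The argument

Write the Cappell–Shaneson sphere as the open gluing `X = jA(T ∖ C) ∪ jB(D̊² × 𝕊²)`
(`Literature.Topology.FourManifolds.IsCircleSurgery`, relation `circleSurgeryRel ν`: `jB (z, v) = jA (ν (z/‖z‖, ‖z‖ • v))` for
`z ≠ 0`), and `𝕊² = D₊ ∪ D₋` with `D₊ = 𝕊² ∖ {s}`, `D₋ = 𝕊² ∖ {n}` (planes). Put
`W = jA(T ∖ C) ∪ jB(D̊² × D₊)`.

1. `H₂(W) = 0` by Mayer–Vietoris in `W` (`mayerVietoris.isZero_of_mono_inter`): `H₂(T ∖ C) = 0`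
   (the new named fact), `D̊² × D₊` is contractible, and `H₁` of the intersection
   `jA(T ∖ C) ∩ jB(D̊² × D₊) = jB((D̊² ∖ 0) × D₊)` injects into `H₁(jA(T ∖ C))`: following the
   inclusion `(D̊² ∖ 0) × D₊ → T ∖ C`, `(z, v) ↦ ν (z/‖z‖, ‖z‖ • v)`, by the bundle projection
   `q : T → ℝ / ℤ` gives a map homotopic — shrink the fibre coordinate `‖z‖ • v` to `0` inside `T` —
   to `(z, v) ↦ q (c (z/‖z‖))`, i.e. to the composite of the homotopy equivalence
   `(D̊² ∖ 0) × D₊ → D̊² ∖ 0 → 𝕊¹` with the homeomorphism `q ∘ c : 𝕊¹ ≃ₜ ℝ / ℤ` (the section circle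
   meets every fibre once). So the inclusion is a monomorphism on `H₁`.
2. `H₂(X) = 0` by Mayer–Vietoris for `X = W ∪ jB(D̊² × D₋)` (`mayerVietoris.isZero_of_isZero_inter`):
   `jB(D̊² × D₋)` is contractible and `W ∩ jB(D̊² × D₋) = jB((D̊² × D₋) ∖ {(0, s)}) ≅ ℝ⁴ ∖ {pt} ≃ S³`
   has `H₁ = 0`.

Step 2 and the cover are those of the Gluck-twist analogue `GluckTwistHomology.lean`, whose
Mayer–Vietoris criteria, punctured-sphere and punctured-`ℝ⁴` homeomorphisms are reused. This is
the homological form of "the surgery creates no 2-homology since the meridian `S²` to `C` bounds a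
punctured copy of `M`" (Gompf, Algebr. Geom. Topol. 10 (2010), §2, proof of Thm. 2.1), organised so
that only `H₂(T ∖ C) = 0` and the bundle projection are needed from the mapping torus.

## Main statements

* `Literature.puncturedDisc.homotopyEquiv : D̊² ∖ 0 ≃ₕ 𝕊¹` (radial projection; proved).
* `Literature.Topology.FourManifolds.exists_bundleProjection`, `Literature.Topology.FourManifolds.bijective_bundleProjection_comp`,
  `Literature.Topology.FourManifolds.exists_homeomorph_bundleProjection_comp` (proved): the bundle projection `T → ℝ / ℤ` of a
  glued mapping torus (`IsOpenGluingWith … (mappingTorusRel φ) jA jB`) and the homeomorphism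
  `𝕊¹ ≃ₜ ℝ / ℤ` it induces on a section circle through a fixed point of `φ`.
* `Literature.Topology.FourManifolds.CircleSurgeryDatum` (the topological data of `IsCircleSurgery`) with the set identities
  `range_jA_inter_range_jB`, `pieceW_union_pieceB`, `pieceW_inter_pieceB`, `range_jA_inter_pieceB`.
* `Literature.Topology.FourManifolds.CircleSurgeryDatum.mono_map_modelInclusion_one`, `isZero_singularHomology_pieceW_two`
  (step 1), `isZero_singularHomology_pieceW_inter_one`, `isZero_singularHomology_two` (step 2),
  `isZero_singularHomology_two_of_facts` (proved): **`H₂ = 0` after surgery on a circle `c` in a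
  4-manifold `T` with `H₂(T ∖ c) = 0` and `c` dual to a map `T → Y` (`q ∘ c` a homeomorphism)**.
* `Literature.Topology.FourManifolds.isZero_singularHomology_two_mappingTorus_compl_sectionCircle` (**named fact**,
  Cappell–Shaneson 1976 §2).
* `Literature.Topology.FourManifolds.IsCappellShanesonSphereOf.isZero_singularHomology_two_of_mayerVietoris`,
  `Literature.Topology.FourManifolds.IsCappellShanesonSphere.isZero_singularHomology_two_of_mayerVietoris` (proved): `H₂(X; ℤ) = 0`
  for every Cappell–Shaneson sphere `X : Type`, from the facts above. Since
  `SPC4.singularHomologyZ X 2` is definitionally `singularHomology ℤ ℤ X 2`, this is the leaf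
  `SPC4.isZero_singularHomologyZ_two_of_isCappellShanesonSphere X` of
  `CappellShanesonHomotopySphere.lean` at universe `0`, modulo the named facts.

## References

* S. E. Cappell, J. L. Shaneson, *Some new four-manifolds*, Ann. of Math. 104 (1976) 61–72, §2
  [CappellShanesonAnnals1976].
* R. E. Gompf, *More Cappell–Shaneson spheres are standard*, Algebr. Geom. Topol. 10 (2010)
  1665–1681, §2, proof of Thm. 2.1 [GompfAGT2010].
* R. E. Gompf, *On Cappell–Shaneson 4-spheres*, Topology Appl. 38 (1991) 123–136, §2 [Gompf1991].
* A. Hatcher, *Algebraic Topology* (2002), Thm. 2.20, §2.2 (p. 149), Cor. 2.14, Ex. 2.48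
  [HatcherAT2002].
* R. Gompf, A. Stipsicz, *4-Manifolds and Kirby Calculus* (1999), §5.2 [GompfStipsicz1999].
* A. Kosinski, *Differential Manifolds* (1993), Ch. VI §1 [Kosinski1993].

## Design notes

* Universe: singular-homology transport (`singularHomology.mapIso`, `isoOfHomotopyEquiv`) needs
  one universe and the models `T ∖ C`, `D̊² × 𝕊²`, `𝕊¹`, `ℝ / ℤ` live in `Type`, so the homology
  sections take `X T : Type`; the datum and the bundle projection are universe-polymorphic.
* `CircleSurgeryDatum` forgets the smooth structure: only the topology of the two open embeddings,
  the relation `circleSurgeryRel ν` and the API of `CircleNbhd` (`CircleSurgeryExistence.lean`: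
  `glue`, `circleSurgeryRel_iff`, `polarInv`) are used.
* No declaration in this file uses `sorry`.
-/

noncomputable section

open Set Function CategoryTheory Limits Topology
open scoped Manifold ContDiff Topology

universe u v

namespace Literature.Topology.FourManifolds

/-- Local notation: `𝔼 n` is the model Euclidean space `EuclideanSpace ℝ (Fin n)`. -/
local notation "𝔼 " n:arg => EuclideanSpace ℝ (Fin n)

/-- Local notation: `𝕊 n` is the unit sphere in `EuclideanSpace ℝ (Fin (n + 1))`. -/
local notation "𝕊 " n:arg => (Metric.sphere (0 : EuclideanSpace ℝ (Fin (n + 1))) 1)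

/-! ### The punctured disc retracts onto the circle -/

section PuncturedDisc

/-- The punctured open unit disc `D̊² ∖ 0 = {z ∈ ℝ² | z ≠ 0, ‖z‖ < 1}`. [folklore] -/
def puncturedDisc : Set (𝔼 2) := {z | z ≠ 0 ∧ ‖z‖ < 1}

namespace puncturedDisc

/-- The radial projection `D̊² ∖ 0 → 𝕊¹`, `z ↦ z / ‖z‖`. [folklore] -/
def radial : C(↥puncturedDisc, 𝕊 1) where
  toFun z := radialProjection (spherePt 1) (z : 𝔼 2)
  continuous_toFun :=
    (continuousOn_radialProjection _).comp_continuous continuous_subtype_val fun z => z.2.1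

/-- `radial z = z / ‖z‖`. [folklore] -/
@[simp] theorem coe_radial_apply (z : ↥puncturedDisc) :
    ((radial z : 𝕊 1) : 𝔼 2) = ‖(z : 𝔼 2)‖⁻¹ • (z : 𝔼 2) :=
  coe_radialProjection_of_ne_zero _ z.2.1

/-- The section `𝕊¹ → D̊² ∖ 0`, `u ↦ u / 2`. [folklore] -/
def half : C(𝕊 1, ↥puncturedDisc) where
  toFun u := ⟨(2 : ℝ)⁻¹ • (u : 𝔼 2),
    ⟨smul_ne_zero (inv_ne_zero two_ne_zero) (ne_zero_of_mem_unit_sphere u), by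
      rw [norm_smul_coe_sphere (show (0 : ℝ) ≤ 2⁻¹ by norm_num) u]; norm_num⟩⟩
  continuous_toFun := (continuous_subtype_val.const_smul (2 : ℝ)⁻¹).subtype_mk _

/-- `half u = u / 2`. [folklore] -/
@[simp] theorem coe_half_apply (u : 𝕊 1) : ((half u : ↥puncturedDisc) : 𝔼 2) = (2 : ℝ)⁻¹ • (u : 𝔼 2) :=
  rfl

/-- `radial ∘ half = id`. [folklore] -/
theorem radial_comp_half : radial.comp half = ContinuousMap.id (𝕊 1) := by
  ext u : 1
  show radialProjection (spherePt 1) ((2 : ℝ)⁻¹ • (u : 𝔼 2)) = u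
  exact radialProjection_smul (spherePt 1) (show (0 : ℝ) < 2⁻¹ by norm_num) u

/-- The coefficient `λ(σ, z) = (1 - σ) / (2‖z‖) + σ` of the straight-line homotopy
`halfRadialHomotopy`. [folklore] -/
def hrCoef (σ : ℝ) (z : 𝔼 2) : ℝ := (1 - σ) * (2 * ‖z‖)⁻¹ + σ

/-- The straight-line homotopy from `half ∘ radial` (`z ↦ z / (2‖z‖)`) to the identity of the
punctured disc, through positive multiples of `z`. [folklore] -/
def halfRadialHomotopy : (half.comp radial).Homotopy (ContinuousMap.id ↥puncturedDisc) where
  toFun p := ⟨hrCoef (p.1 : ℝ) (p.2 : 𝔼 2) • (p.2 : 𝔼 2), by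
    obtain ⟨⟨σ, hσ0, hσ1⟩, ⟨z, hz0, hz1⟩⟩ := p
    have hz : 0 < ‖z‖ := norm_pos_iff.2 hz0
    simp only [hrCoef]
    have hcoef : 0 < (1 - σ) * (2 * ‖z‖)⁻¹ + σ := by
      rcases hσ0.lt_or_eq with h | rfl
      · exact add_pos_of_nonneg_of_pos (mul_nonneg (by linarith) (by positivity)) h
      · simp only [sub_zero, one_mul, add_zero]; positivity
    refine ⟨smul_ne_zero hcoef.ne' hz0, ?_⟩
    rw [norm_smul, Real.norm_of_nonneg hcoef.le]
    have key : ((1 - σ) * (2 * ‖z‖)⁻¹ + σ) * ‖z‖ = (1 - σ) / 2 + σ * ‖z‖ := by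
      field_simp
    rw [key]
    -- `(1 - σ) / 2 + σ ‖z‖ < 1`
    have h1 : σ * ‖z‖ ≤ σ := mul_le_of_le_one_right hσ0 hz1.le
    rcases hσ1.lt_or_eq with h | rfl
    · linarith
    · linarith⟩
  continuous_toFun := by
    have hσ : Continuous fun p : unitInterval × ↥puncturedDisc => (p.1 : ℝ) :=
      continuous_subtype_val.comp continuous_fst
    have hz : Continuous fun p : unitInterval × ↥puncturedDisc => (p.2 : 𝔼 2) :=
      continuous_subtype_val.comp continuous_snd
    have hcoef : Continuous fun p : unitInterval × ↥puncturedDisc =>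
        hrCoef (p.1 : ℝ) (p.2 : 𝔼 2) := by
      unfold hrCoef
      refine ((continuous_const.sub hσ).mul ((continuous_const.mul hz.norm).inv₀ ?_)).add hσ
      intro p
      exact mul_ne_zero two_ne_zero (norm_ne_zero_iff.2 p.2.2.1)
    exact (hcoef.smul hz).subtype_mk _
  map_zero_left z := by
    apply Subtype.ext
    have h0 : ((0 : unitInterval) : ℝ) = 0 := rfl
    simp only [ContinuousMap.comp_apply, coe_half_apply, coe_radial_apply, smul_smul, h0, hrCoef,
      sub_zero, one_mul, add_zero, mul_inv]
  map_one_left z := by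
    apply Subtype.ext
    have h1 : ((1 : unitInterval) : ℝ) = 1 := rfl
    simp only [ContinuousMap.id_apply, h1, hrCoef, sub_self, zero_mul, zero_add, one_smul]

/-- **`D̊² ∖ 0 ≃ 𝕊¹`**: the radial projection of the punctured disc onto the circle is a homotopy
equivalence, with homotopy inverse `u ↦ u / 2`. [folklore] -/
def homotopyEquiv : ContinuousMap.HomotopyEquiv ↥puncturedDisc (𝕊 1) where
  toFun := radial
  invFun := half
  left_inv := ⟨halfRadialHomotopy⟩
  right_inv := by rw [radial_comp_half]

/-- The forward map of `puncturedDisc.homotopyEquiv` is the radial projection. [folklore] -/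
@[simp] theorem homotopyEquiv_toFun : homotopyEquiv.toFun = radial := rfl

end puncturedDisc

end PuncturedDisc

/-! ### The bundle projection of a glued mapping torus and its section circle -/

section GluedContinuity

variable {A B P P' : Type*} [TopologicalSpace A] [TopologicalSpace B] [TopologicalSpace P]
  [TopologicalSpace P'] {jA : A → P} {jB : B → P} {jA' : A → P'} {jB' : B → P'}

/-- The comparison map `G : P → P'` out of a space covered by two open embeddings, with
`G ∘ jA`, `G ∘ jB` continuous, is continuous (Kosinski, *Differential Manifolds*, VI.1, proof of
(1.1), topological part). Private copy of `Literature.Topology.FourManifolds.continuous_of_comp_isOpenEmbedding` of the sibling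
file `CappellShanesonHomotopySphere.lean`, kept private so that the two files are independent.
[cite: Kosinski1993, Ch. VI §1, proof of Thm (1.1)] -/
private theorem continuous_of_comp_isOpenEmbedding' (hA : IsOpenEmbedding jA) (hB : IsOpenEmbedding jB)
    (hU : range jA ∪ range jB = univ) (hA' : Continuous jA') (hB' : Continuous jB')
    {G : P → P'} (hGA : ∀ a, G (jA a) = jA' a) (hGB : ∀ b, G (jB b) = jB' b) :
    Continuous G := by
  rw [continuous_iff_continuousAt]
  intro p
  rcases eq_univ_iff_forall.1 hU p with ⟨a, rfl⟩ | ⟨b, rfl⟩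
  · rw [ContinuousAt, ← hA.map_nhds_eq, Filter.tendsto_map'_iff, hGA]
    have : G ∘ jA = jA' := funext hGA
    rw [this]
    exact hA'.continuousAt
  · rw [ContinuousAt, ← hB.map_nhds_eq, Filter.tendsto_map'_iff, hGB]
    have : G ∘ jB = jB' := funext hGB
    rw [this]
    exact hB'.continuousAt

end GluedContinuity

section BundleProjection

variable {T : Type u} [TopologicalSpace T] {M : Type v} [TopologicalSpace M]
  {jA : M × ↥mappingTorusPieceOne → T} {jB : M × ↥mappingTorusPieceTwo → T} {φ : M → M}

/-- **The bundle projection of a glued mapping torus.** If `T = jA(M × (0, 1)) ∪ jB(M × (1/2, 3/2))`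
is covered by two open embeddings identifying exactly the `mappingTorusRel φ`-related points, then
`jA (x, s) ↦ [s]`, `jB (y, t) ↦ [t]` is a well defined continuous map `T → ℝ / ℤ`
(the second clause of the relation changes `t` by the period `1`) (Hatcher, *Algebraic Topology*,
Ex. 2.48; Cappell–Shaneson, Ann. of Math. 104 (1976), §1; compare `MappingTorus.proj`). [folklore] -/
theorem exists_bundleProjection (hA : IsOpenEmbedding jA) (hB : IsOpenEmbedding jB)
    (hU : range jA ∪ range jB = univ) (hR : ∀ a b, jA a = jB b ↔ mappingTorusRel φ a b) :
    ∃ p : C(T, AddCircle (1 : ℝ)), (∀ a, p (jA a) = ((a.2 : ℝ) : AddCircle (1 : ℝ))) ∧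
      ∀ b, p (jB b) = ((b.2 : ℝ) : AddCircle (1 : ℝ)) := by
  have hcomp : ∀ a b, jA a = jB b →
      (fun a : M × ↥mappingTorusPieceOne => ((a.2 : ℝ) : AddCircle (1 : ℝ))) a =
        (fun b : M × ↥mappingTorusPieceTwo => ((b.2 : ℝ) : AddCircle (1 : ℝ))) b := by
    intro a b hab
    rcases (hR a b).1 hab with ⟨h, -⟩ | ⟨h, -⟩
    · simp only [h]
    · simp only [h, AddCircle.coe_add_period]
  obtain ⟨G, hGA, hGB⟩ := IsOpenGluing.exists_map_apply_eq hU hA.injective hB.injective hcomp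
  have hcA : Continuous fun a : M × ↥mappingTorusPieceOne => ((a.2 : ℝ) : AddCircle (1 : ℝ)) :=
    continuous_quotient_mk'.comp (continuous_subtype_val.comp continuous_snd)
  have hcB : Continuous fun b : M × ↥mappingTorusPieceTwo => ((b.2 : ℝ) : AddCircle (1 : ℝ)) :=
    continuous_quotient_mk'.comp (continuous_subtype_val.comp continuous_snd)
  have hGc : Continuous G := continuous_of_comp_isOpenEmbedding' hA hB hU hcA hcB hGA hGB
  exact ⟨⟨G, hGc⟩, hGA, hGB⟩

omit [TopologicalSpace T] [TopologicalSpace M] in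
/-- **The section circle maps bijectively onto the base circle.** Let `p : T → ℝ / ℤ` be a bundle
projection as in `exists_bundleProjection` and let `c : 𝕊¹ → T` be injective with image the
section `jA({x₀} × (0, 1)) ∪ jB({x₀} × (1/2, 3/2))` through a fixed point `x₀` of `φ`. Then
`p ∘ c` is a bijection `𝕊¹ → ℝ / ℤ`: on the section, `p` takes every value of `ℝ / ℤ` exactly once
(`[s]`, `s ∈ (0, 1]`), the two parametrisations agreeing on their overlap by the gluing relation
(Cappell–Shaneson 1976, §2: the section circle of `T_A` through the fixed point). [folklore] -/
theorem bijective_bundleProjection_comp (hR : ∀ a b, jA a = jB b ↔ mappingTorusRel φ a b)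
    (p : T → AddCircle (1 : ℝ)) (hpA : ∀ a, p (jA a) = ((a.2 : ℝ) : AddCircle (1 : ℝ)))
    (hpB : ∀ b, p (jB b) = ((b.2 : ℝ) : AddCircle (1 : ℝ))) {x₀ : M} (hx₀ : φ x₀ = x₀)
    {S : Type*} {c : S → T} (hc : Injective c)
    (hrange : range c = jA '' ({x₀} ×ˢ univ) ∪ jB '' ({x₀} ×ˢ univ)) :
    Bijective (p ∘ c) := by
  -- the two parametrised pieces of the section and their `p`-values
  have hAmem : ∀ s : ↥mappingTorusPieceOne, (s : ℝ) ∈ Ioo (0 : ℝ) 1 := fun s => s.2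
  have hBmem : ∀ t : ↥mappingTorusPieceTwo, (t : ℝ) ∈ Ioo (1 / 2 : ℝ) (3 / 2) := fun t => t.2
  -- `jA (x₀, s) = jB (x₀, t)` as soon as `[s] = [t]`
  have hAB : ∀ (s : ↥mappingTorusPieceOne) (t : ↥mappingTorusPieceTwo),
      ((s : ℝ) : AddCircle (1 : ℝ)) = ((t : ℝ) : AddCircle (1 : ℝ)) → jA (x₀, s) = jB (x₀, t) := by
    intro s t hst
    rw [hR]
    obtain ⟨hs0, hs1⟩ := hAmem s
    obtain ⟨ht0, ht1⟩ := hBmem t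
    rw [eq_comm, QuotientAddGroup.eq_iff_sub_mem, AddSubgroup.mem_zmultiples_iff] at hst
    obtain ⟨k, hk⟩ := hst
    rw [zsmul_eq_mul, mul_one] at hk
    have hk0 : (-1 : ℤ) < k := by
      have : (-1 : ℝ) < k := by linarith
      exact_mod_cast this
    have hk1 : k < (2 : ℤ) := by
      have : (k : ℝ) < 2 := by linarith
      exact_mod_cast this
    have hk' : k = 0 ∨ k = 1 := by omega
    rcases hk' with rfl | rfl
    · left
      rw [Int.cast_zero, eq_comm, sub_eq_zero] at hk
      exact ⟨hk, rfl⟩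
    · right
      refine ⟨?_, hx₀.symm⟩
      rw [Int.cast_one] at hk
      change ((t : ℝ)) = (s : ℝ) + 1
      linarith
  -- every point of the section is `jA (x₀, s)` or `jB (x₀, t)`
  have hcase : ∀ z ∈ range c, (∃ s, z = jA (x₀, s)) ∨ ∃ t, z = jB (x₀, t) := by
    intro z hz
    rw [hrange] at hz
    rcases hz with ⟨⟨x, s⟩, ⟨hx, -⟩, rfl⟩ | ⟨⟨x, t⟩, ⟨hx, -⟩, rfl⟩
    · have hx' : x = x₀ := hx
      subst hx'
      exact Or.inl ⟨s, rfl⟩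
    · have hx' : x = x₀ := hx
      subst hx'
      exact Or.inr ⟨t, rfl⟩
  have hIcoA : ∀ s : ↥mappingTorusPieceOne, (s : ℝ) ∈ Ico (0 : ℝ) (0 + 1) := fun s => by
    rw [zero_add]; exact Ioo_subset_Ico_self (hAmem s)
  have hIcoB : ∀ t : ↥mappingTorusPieceTwo, (t : ℝ) ∈ Ico (1 / 2 : ℝ) (1 / 2 + 1) := fun t => by
    norm_num; exact Ioo_subset_Ico_self (hBmem t)
  refine ⟨fun u₁ u₂ h => hc ?_, fun θ => ?_⟩
  · -- injectivity
    change p (c u₁) = p (c u₂) at h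
    rcases hcase (c u₁) (mem_range_self _) with ⟨s₁, h₁⟩ | ⟨t₁, h₁⟩ <;>
      rcases hcase (c u₂) (mem_range_self _) with ⟨s₂, h₂⟩ | ⟨t₂, h₂⟩ <;>
        rw [h₁, h₂] at h ⊢
    · rw [hpA, hpA] at h
      rw [Subtype.ext ((AddCircle.coe_eq_coe_iff_of_mem_Ico (hIcoA s₁) (hIcoA s₂)).1 h)]
    · rw [hpA, hpB] at h
      exact hAB s₁ t₂ h
    · rw [hpB, hpA] at h
      exact (hAB s₂ t₁ h.symm).symm
    · rw [hpB, hpB] at h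
      rw [Subtype.ext ((AddCircle.coe_eq_coe_iff_of_mem_Ico (hIcoB t₁) (hIcoB t₂)).1 h)]
  · -- surjectivity: `θ = [s]` with `s ∈ (0, 1]`
    have hθ : θ ∈ ((↑) : ℝ → AddCircle (1 : ℝ)) '' Ioc (0 : ℝ) (0 + 1) := by
      rw [AddCircle.coe_image_Ioc_eq]; exact mem_univ θ
    obtain ⟨s, ⟨hs0, hs1⟩, rfl⟩ := hθ
    rw [zero_add] at hs1
    rcases hs1.lt_or_eq with hs1 | rfl
    · have hmem : jA (x₀, ⟨s, ⟨hs0, hs1⟩⟩) ∈ range c := by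
        rw [hrange]
        exact Or.inl ⟨(x₀, ⟨s, ⟨hs0, hs1⟩⟩), ⟨rfl, mem_univ _⟩, rfl⟩
      obtain ⟨u, hu⟩ := hmem
      exact ⟨u, by change p (c u) = _; rw [hu, hpA]⟩
    · have h1 : (1 : ℝ) ∈ Ioo (1 / 2 : ℝ) (3 / 2) := by norm_num
      have hmem : jB (x₀, ⟨1, h1⟩) ∈ range c := by
        rw [hrange]
        exact Or.inr ⟨(x₀, ⟨1, h1⟩), ⟨rfl, mem_univ _⟩, rfl⟩
      obtain ⟨u, hu⟩ := hmem
      exact ⟨u, by change p (c u) = _; rw [hu, hpB]⟩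

omit [TopologicalSpace M] in
/-- **The section circle is identified with the base circle** by the bundle projection: for `c`
a continuous injection of the (compact) circle `𝕊¹` onto the section through a fixed point, the
continuous bijection `p ∘ c : 𝕊¹ → ℝ / ℤ` is a homeomorphism (compact to Hausdorff).
[folklore] -/
theorem exists_homeomorph_bundleProjection_comp (hR : ∀ a b, jA a = jB b ↔ mappingTorusRel φ a b)
    (p : C(T, AddCircle (1 : ℝ))) (hpA : ∀ a, p (jA a) = ((a.2 : ℝ) : AddCircle (1 : ℝ)))
    (hpB : ∀ b, p (jB b) = ((b.2 : ℝ) : AddCircle (1 : ℝ))) {x₀ : M} (hx₀ : φ x₀ = x₀)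
    {c : 𝕊 1 → T} (hcont : Continuous c) (hc : Injective c)
    (hrange : range c = jA '' ({x₀} ×ˢ univ) ∪ jB '' ({x₀} ×ˢ univ)) :
    ∃ e : 𝕊 1 ≃ₜ AddCircle (1 : ℝ), ∀ u, e u = p (c u) :=
  ⟨Continuous.homeoOfEquivCompactToT2
      (f := Equiv.ofBijective (p ∘ c) (bijective_bundleProjection_comp hR p hpA hpB hx₀ hc hrange))
      (p.continuous.comp hcont),
    fun _ => rfl⟩

end BundleProjection

end Literature.Topology.FourManifolds

namespace Literature.Topology.FourManifolds

/-- Local notation: `𝔼 n` is the model Euclidean space `EuclideanSpace ℝ (Fin n)`. -/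
local notation "𝔼 " n:arg => EuclideanSpace ℝ (Fin n)

/-- Local notation: `𝕊 n` is the unit sphere in `EuclideanSpace ℝ (Fin (n + 1))`. -/
local notation "𝕊 " n:arg => (Metric.sphere (0 : EuclideanSpace ℝ (Fin (n + 1))) 1)

open SphereTwo

/-! ### The open pieces of a circle surgery -/

section SurgeryDatum

variable {T : Type u} [TopologicalSpace T] [T2Space T] [ChartedSpace (𝔼 4) T] {c : 𝕊 1 → T}
  {X : Type v} [TopologicalSpace X]

/-- The data of an open relational circle surgery `X = (T ∖ c) ∪_{circleSurgeryRel ν} (D̊² × 𝕊²)`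
underlying `Literature.Topology.FourManifolds.IsCircleSurgery` (the tubular neighbourhood `ν` of the circle `c` and the two
gluing maps as topological embeddings with open ranges covering `X`, related by
`circleSurgeryRel ν`); the smoothness of the gluing maps is forgotten (Gompf–Stipsicz,
*4-Manifolds and Kirby Calculus* (1999), §5.2). [folklore] -/
structure CircleSurgeryDatum (c : 𝕊 1 → T) (X : Type v) [TopologicalSpace X] where
  /-- The tubular neighbourhood of `c` used for the surgery. -/
  ν : CircleNbhd (𝓡 4) c
  /-- The gluing map of the circle complement `T ∖ c(𝕊¹)`. -/
  jA : ↥ν.complement → X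
  /-- The gluing map of the new piece `D̊² × 𝕊²`. -/
  jB : ↥discTimesSphere → X
  /-- `jA` is a topological embedding. -/
  hA : IsEmbedding jA
  /-- The range of `jA` is open. -/
  hAo : IsOpen (range jA)
  /-- `jB` is a topological embedding. -/
  hB : IsEmbedding jB
  /-- The range of `jB` is open. -/
  hBo : IsOpen (range jB)
  /-- The two ranges cover `X`. -/
  hU : range jA ∪ range jB = univ
  /-- The gluing relation: `jA a = jB b ↔ circleSurgeryRel ν a b`. -/
  hR : ∀ a b, jA a = jB b ↔ circleSurgeryRel ν a b

/-- A circle surgery in the sense of `Literature.Topology.FourManifolds.IsCircleSurgery` (target charted on `ℝ⁴`) carries a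
`CircleSurgeryDatum`. [folklore] -/
theorem IsCircleSurgery.nonempty_circleSurgeryDatum [ChartedSpace (𝔼 4) X]
    (h : IsCircleSurgery (𝓡 4) (𝓡 4) T X c) : Nonempty (CircleSurgeryDatum c X) := by
  obtain ⟨ν, jA, jB, hA, hAo, hB, hBo, hU, hR⟩ := h
  exact ⟨⟨ν, jA, jB, hA.isEmbedding, hAo, hB.isEmbedding, hBo, hU, hR⟩⟩

/-- The new piece punctured along its core sphere: `(D̊² ∖ 0) × 𝕊²`, as a subtype of
`D̊² × 𝕊²`. [folklore] -/
abbrev PuncturedCore : Type := {b : ↥discTimesSphere // ((b : (𝔼 2) × (𝕊 2)).1) ≠ 0}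

namespace CircleSurgeryDatum

variable (G : CircleSurgeryDatum c X)

/-- `jA` is an open embedding. [folklore] -/
theorem isOpenEmbedding_jA : IsOpenEmbedding G.jA := ⟨G.hA, G.hAo⟩

/-- `jB` is an open embedding. [folklore] -/
theorem isOpenEmbedding_jB : IsOpenEmbedding G.jB := ⟨G.hB, G.hBo⟩

/-- A point of the punctured new piece lies in the target of the gluing partial homeomorphism
`ν.glue : (T ∖ c) ⇀ D̊² × 𝕊²`. [folklore] -/
theorem mem_glue_target (b : PuncturedCore) : (b.1 : ↥discTimesSphere) ∈ G.ν.glueData.glue.target := by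
  rw [CircleNbhd.glueData_glue, CircleNbhd.glue_target]
  exact b.2

/-- The model of the inclusion of the gluing region into the circle complement:
`(D̊² ∖ 0) × 𝕊² → T ∖ c`, `(z, v) ↦ ν (z / ‖z‖, ‖z‖ • v)` (the inverse gluing map `ν.glue.symm`).
[folklore] -/
def toComplement : C(PuncturedCore, ↥G.ν.complement) where
  toFun b := G.ν.glueData.glue.symm b.1
  continuous_toFun :=
    G.ν.glueData.glue.continuousOn_symm.comp_continuous continuous_subtype_val G.mem_glue_target

/-- Values of `toComplement` in `T`: `ν (z / ‖z‖, ‖z‖ • v)`. [folklore] -/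
theorem coe_toComplement_apply (b : PuncturedCore) :
    (G.toComplement b : T) = G.ν.toFun (CircleNbhd.polarInv (b.1 : (𝔼 2) × (𝕊 2))) := by
  change ((G.ν.glueData.glue.symm b.1 : ↥G.ν.complement) : T) = _
  rw [CircleNbhd.glueData_glue, CircleNbhd.glue_symm_apply, CircleNbhd.coe_bwdA_apply _ b.2]

/-- The gluing relation, solved: `jA (ν (z / ‖z‖, ‖z‖ • v)) = jB (z, v)` for `z ≠ 0`. [folklore] -/
theorem jA_toComplement (b : PuncturedCore) : G.jA (G.toComplement b) = G.jB b.1 := by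
  rw [G.hR, G.ν.circleSurgeryRel_iff]
  exact ⟨G.ν.glueData.glue.map_target (G.mem_glue_target b),
    G.ν.glueData.glue.right_inv (G.mem_glue_target b)⟩

/-- A point `jB (z, v)` of the new piece lies in `jA(T ∖ c)` iff `z ≠ 0`. [folklore] -/
theorem jB_mem_range_jA_iff (b : ↥discTimesSphere) :
    G.jB b ∈ range G.jA ↔ ((b : (𝔼 2) × (𝕊 2)).1) ≠ 0 := by
  constructor
  · rintro ⟨a, ha⟩
    have hrel := (G.ν.circleSurgeryRel_iff a b).1 ((G.hR a b).1 ha)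
    have hb : b ∈ G.ν.glueData.glue.target := hrel.2 ▸ G.ν.glueData.glue.map_source hrel.1
    rw [CircleNbhd.glueData_glue, CircleNbhd.glue_target] at hb
    exact hb
  · intro hb
    exact ⟨G.toComplement ⟨b, hb⟩, G.jA_toComplement ⟨b, hb⟩⟩

/-- `jA(T ∖ c) ∩ jB(D̊² × 𝕊²) = jB((D̊² ∖ 0) × 𝕊²)`. [folklore] -/
theorem range_jA_inter_range_jB :
    range G.jA ∩ range G.jB = G.jB '' {b | ((b : (𝔼 2) × (𝕊 2)).1) ≠ 0} := by
  ext y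
  constructor
  · rintro ⟨hyA, ⟨b, rfl⟩⟩
    exact ⟨b, (G.jB_mem_range_jA_iff b).1 hyA, rfl⟩
  · rintro ⟨b, hb, rfl⟩
    exact ⟨(G.jB_mem_range_jA_iff b).2 hb, mem_range_self _⟩

/-- The open piece `V_D = jB (D̊² × D)` of the surgered manifold over a subset `D ⊆ 𝕊²`.
[folklore] -/
def pieceB (D : Set (𝕊 2)) : Set X := G.jB '' {b | ((b : (𝔼 2) × (𝕊 2)).2) ∈ D}

/-- The pieces `jB (D̊² × D)` over open `D` are open. [folklore] -/
theorem isOpen_pieceB {D : Set (𝕊 2)} (hD : IsOpen D) : IsOpen (G.pieceB D) :=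
  G.isOpenEmbedding_jB.isOpenMap _
    (hD.preimage (continuous_snd.comp continuous_subtype_val))

/-- Membership in `jB (D̊² × D)`. [folklore] -/
theorem mem_pieceB_iff {D : Set (𝕊 2)} {b : ↥discTimesSphere} :
    G.jB b ∈ G.pieceB D ↔ ((b : (𝔼 2) × (𝕊 2)).2) ∈ D := by
  constructor
  · rintro ⟨b', hb', hbb'⟩
    rw [G.hB.injective hbb'] at hb'
    exact hb'
  · exact fun h => ⟨b, h, rfl⟩

/-- The punctured sphere `D₊ = 𝕊² ∖ {south pole}`. [folklore] -/
abbrev Dplus : Set (𝕊 2) := {southPole}ᶜ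

/-- The punctured sphere `D₋ = 𝕊² ∖ {north pole}`. [folklore] -/
abbrev Dminus : Set (𝕊 2) := {northPole}ᶜ

/-- The intermediate open piece `W = jA(T ∖ c) ∪ jB(D̊² × (𝕊² ∖ {s}))`. [folklore] -/
def pieceW : Set X := range G.jA ∪ G.pieceB Dplus

/-- `W` is open. [folklore] -/
theorem isOpen_pieceW : IsOpen G.pieceW :=
  G.hAo.union (G.isOpen_pieceB isOpen_compl_singleton)

/-- `X = W ∪ jB(D̊² × (𝕊² ∖ {n}))`. [folklore] -/
theorem pieceW_union_pieceB : G.pieceW ∪ G.pieceB Dminus = univ := by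
  refine eq_univ_of_forall fun y => ?_
  have hy : y ∈ range G.jA ∪ range G.jB := by rw [G.hU]; exact mem_univ y
  rcases hy with hy | ⟨b, rfl⟩
  · exact Or.inl (Or.inl hy)
  · by_cases hb : ((b : (𝔼 2) × (𝕊 2)).2) = southPole
    · refine Or.inr (G.mem_pieceB_iff.2 ?_)
      rw [hb]
      exact southPole_ne_northPole
    · exact Or.inl (Or.inr (G.mem_pieceB_iff.2 hb))

/-- The subset `{(z, v) | v ≠ n, (v ≠ s ∨ z ≠ 0)}` of `D̊² × 𝕊²` parametrising `W ∩ V₋`.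
[folklore] -/
def modelT : Set ↥discTimesSphere :=
  {b | ((b : (𝔼 2) × (𝕊 2)).2) ≠ northPole ∧
    (((b : (𝔼 2) × (𝕊 2)).2) ≠ southPole ∨ ((b : (𝔼 2) × (𝕊 2)).1) ≠ 0)}

/-- `W ∩ jB(D̊² × (𝕊² ∖ {n})) = jB(T)`. [folklore] -/
theorem pieceW_inter_pieceB : G.pieceW ∩ G.pieceB Dminus = G.jB '' modelT := by
  ext y
  constructor
  · rintro ⟨hW, ⟨b, hb, rfl⟩⟩
    refine ⟨b, ⟨hb, ?_⟩, rfl⟩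
    rcases hW with hA | hB
    · exact Or.inr ((G.jB_mem_range_jA_iff b).1 hA)
    · exact Or.inl (G.mem_pieceB_iff.1 hB)
  · rintro ⟨b, ⟨hb, h⟩, rfl⟩
    refine ⟨?_, G.mem_pieceB_iff.2 hb⟩
    rcases h with h | h
    · exact Or.inr (G.mem_pieceB_iff.2 h)
    · exact Or.inl ((G.jB_mem_range_jA_iff b).2 h)

/-- The subset `S₊ = {(z, v) | z ≠ 0, v ≠ s}` of the punctured new piece parametrising
`jA(T ∖ c) ∩ jB(D̊² × (𝕊² ∖ {s}))`. [folklore] -/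
def modelS : Set PuncturedCore := {b | (((b.1 : ↥discTimesSphere) : (𝔼 2) × (𝕊 2)).2) ≠ southPole}

/-- `jA(T ∖ c) ∩ jB(D̊² × (𝕊² ∖ {s})) = jA(ν(S₊))`. [folklore] -/
theorem range_jA_inter_pieceB :
    range G.jA ∩ G.pieceB Dplus = range (fun b : ↥modelS => G.jA (G.toComplement b.1)) := by
  ext y
  constructor
  · rintro ⟨hyA, ⟨b, hb, rfl⟩⟩
    have hb0 : ((b : (𝔼 2) × (𝕊 2)).1) ≠ 0 := (G.jB_mem_range_jA_iff b).1 hyA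
    exact ⟨⟨⟨b, hb0⟩, hb⟩, G.jA_toComplement ⟨b, hb0⟩⟩
  · rintro ⟨⟨b, hb⟩, rfl⟩
    change G.jA (G.toComplement b) ∈ range G.jA ∩ G.pieceB Dplus
    rw [G.jA_toComplement]
    exact ⟨(G.jB_mem_range_jA_iff _).2 b.2, G.mem_pieceB_iff.2 hb⟩

end CircleSurgeryDatum

end SurgeryDatum

end Literature.Topology.FourManifolds

namespace Literature.Topology.FourManifolds

/-- Local notation: `𝔼 n` is the model Euclidean space `EuclideanSpace ℝ (Fin n)`. -/
local notation "𝔼 " n:arg => EuclideanSpace ℝ (Fin n)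

/-- Local notation: `𝕊 n` is the unit sphere in `EuclideanSpace ℝ (Fin (n + 1))`. -/
local notation "𝕊 " n:arg => (Metric.sphere (0 : EuclideanSpace ℝ (Fin (n + 1))) 1)

open SphereTwo

/-! ### Models of the pieces: contractibility and homotopy types -/

section Models

/-- The open unit disc `D̊²` is contractible (convex). [folklore] -/
instance contractibleSpace_ball_two : ContractibleSpace ↥(Metric.ball (0 : 𝔼 2) 1) :=
  (convex_ball (0 : 𝔼 2) 1).contractibleSpace ⟨0, Metric.mem_ball_self one_pos⟩

/-- `D̊² × D ⊆ D̊² × 𝕊²` (as a subset of the new piece) is homeomorphic to the product.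
[folklore] -/
def discTimesSetHomeomorph (D : Set (𝕊 2)) :
    ↥{b : ↥discTimesSphere | ((b : (𝔼 2) × (𝕊 2)).2) ∈ D} ≃ₜ ↥(Metric.ball (0 : 𝔼 2) 1) × ↥D where
  toFun b := (⟨((b.1 : (𝔼 2) × (𝕊 2)).1), mem_ball_zero_iff.2 b.1.2⟩, ⟨((b.1 : (𝔼 2) × (𝕊 2)).2), b.2⟩)
  invFun q := ⟨⟨((q.1 : 𝔼 2), (q.2 : 𝕊 2)), by
    rw [mem_discTimesSphere_iff]; exact mem_ball_zero_iff.1 q.1.2⟩, q.2.2⟩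
  left_inv _ := rfl
  right_inv _ := rfl
  continuous_toFun := by fun_prop
  continuous_invFun := by fun_prop

/-- `D̊² × (𝕊² ∖ {v})` is contractible. [folklore] -/
instance contractibleSpace_discTimesPuncturedSphere (v : 𝕊 2) :
    ContractibleSpace ↥{b : ↥discTimesSphere | ((b : (𝔼 2) × (𝕊 2)).2) ∈ ({v}ᶜ : Set (𝕊 2))} :=
  (discTimesSetHomeomorph ({v}ᶜ : Set (𝕊 2))).contractibleSpace

/-- `S₊ ≃ₜ (D̊² ∖ 0) × (𝕊² ∖ {s})`. [folklore] -/
def modelSHomeomorph :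
    ↥CircleSurgeryDatum.modelS ≃ₜ ↥puncturedDisc × ↥(CircleSurgeryDatum.Dplus : Set (𝕊 2)) where
  toFun b := (⟨((b.1.1 : (𝔼 2) × (𝕊 2)).1), b.1.2, b.1.1.2⟩, ⟨((b.1.1 : (𝔼 2) × (𝕊 2)).2), b.2⟩)
  invFun y := ⟨⟨⟨((y.1 : 𝔼 2), (y.2 : 𝕊 2)), y.1.2.2⟩, y.1.2.1⟩, y.2.2⟩
  left_inv _ := rfl
  right_inv _ := rfl
  continuous_toFun := by fun_prop
  continuous_invFun := by fun_prop

/-- The disc coordinate `S₊ → D̊² ∖ 0`. [folklore] -/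
def modelSDisc : C(↥CircleSurgeryDatum.modelS, ↥puncturedDisc) :=
  ContinuousMap.fst.comp
    (modelSHomeomorph :
      C(↥CircleSurgeryDatum.modelS, ↥puncturedDisc × ↥(CircleSurgeryDatum.Dplus : Set (𝕊 2))))

/-- **`S₊ ≃ 𝕊¹`**: `S₊ ≅ (D̊² ∖ 0) × (𝕊² ∖ {s}) → D̊² ∖ 0 → 𝕊¹` (drop the contractible factor,
then project radially) is a homotopy equivalence. [folklore] -/
def modelSHomotopyEquiv : ContinuousMap.HomotopyEquiv ↥CircleSurgeryDatum.modelS (𝕊 1) :=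
  (modelSHomeomorph.toHomotopyEquiv.trans
    (HomotopyEquiv.fstOfContractible ↥puncturedDisc ↥(CircleSurgeryDatum.Dplus : Set (𝕊 2)))).trans
    puncturedDisc.homotopyEquiv

/-- The forward map of `modelSHomotopyEquiv` is `(z, v) ↦ z / ‖z‖`. [folklore] -/
theorem modelSHomotopyEquiv_toFun_apply (b : ↥CircleSurgeryDatum.modelS) :
    modelSHomotopyEquiv.toFun b = puncturedDisc.radial (modelSDisc b) := rfl

/-- The base point `(0, s)` of `D̊² × (𝕊² ∖ {n})` removed in `T`. [folklore] -/
def basePointT : ↥(Metric.ball (0 : 𝔼 2) 1) × ↥(CircleSurgeryDatum.Dminus : Set (𝕊 2)) :=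
  (⟨0, Metric.mem_ball_self one_pos⟩, ⟨southPole, southPole_ne_northPole⟩)

/-- `T ≃ₜ (D̊² × (𝕊² ∖ {n})) ∖ {(0, s)}`. [folklore] -/
def modelTHomeomorph :
    ↥CircleSurgeryDatum.modelT ≃ₜ
      {q : ↥(Metric.ball (0 : 𝔼 2) 1) × ↥(CircleSurgeryDatum.Dminus : Set (𝕊 2)) // q ≠ basePointT} where
  toFun b := ⟨(⟨((b.1 : (𝔼 2) × (𝕊 2)).1), mem_ball_zero_iff.2 b.1.2⟩,
      ⟨((b.1 : (𝔼 2) × (𝕊 2)).2), b.2.1⟩), fun h => by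
    have h1 : ((b.1 : (𝔼 2) × (𝕊 2)).2) = southPole :=
      congrArg (fun q : ↥(Metric.ball (0 : 𝔼 2) 1) × ↥(CircleSurgeryDatum.Dminus : Set (𝕊 2)) =>
        (q.2 : 𝕊 2)) h
    have h2 : ((b.1 : (𝔼 2) × (𝕊 2)).1) = 0 :=
      congrArg (fun q : ↥(Metric.ball (0 : 𝔼 2) 1) × ↥(CircleSurgeryDatum.Dminus : Set (𝕊 2)) =>
        (q.1 : 𝔼 2)) h
    exact b.2.2.elim (fun h' => h' h1) (fun h' => h' h2)⟩
  invFun y := ⟨⟨((y.1.1 : 𝔼 2), (y.1.2 : 𝕊 2)), by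
      rw [mem_discTimesSphere_iff]; exact mem_ball_zero_iff.1 y.1.1.2⟩, y.1.2.2, by
    by_contra h
    simp only [not_or, not_ne_iff] at h
    exact y.2 (Prod.ext (Subtype.ext h.2) (Subtype.ext h.1))⟩
  left_inv _ := rfl
  right_inv _ := rfl
  continuous_toFun := by fun_prop
  continuous_invFun := by fun_prop

/-- `(D̊² × (𝕊² ∖ {n})) ∖ {(0, s)} ≃ₜ (ℝ² × ℝ²) ∖ {pt}`: the unit-ball homeomorphism on the first
factor and stereographic projection from `n` on the second. [folklore] -/
def puncturedModelTHomeomorph :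
    {q : ↥(Metric.ball (0 : 𝔼 2) 1) × ↥(CircleSurgeryDatum.Dminus : Set (𝕊 2)) // q ≠ basePointT} ≃ₜ
      {q : 𝔼 2 × 𝔼 2 // q ≠ ((Homeomorph.unitBall (E := 𝔼 2)).symm.prodCongr
        (sphereTwoMinusPointHomeomorph northPole)) basePointT} :=
  ((Homeomorph.unitBall (E := 𝔼 2)).symm.prodCongr (sphereTwoMinusPointHomeomorph northPole)).subtype
    (fun q => by rw [Ne, Ne, Homeomorph.injective _ |>.eq_iff])

/-- **`T ≅ ℝ⁴ ∖ {0}`** (`T = (D̊² × (𝕊² ∖ {n})) ∖ {(0, s)}`), whence `T ≃ S³`. [folklore] -/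
def modelTHomeomorphPunctured : ↥CircleSurgeryDatum.modelT ≃ₜ ↥(Literature.AlgebraicTopology.SingularHomology.punctured 4) :=
  modelTHomeomorph.trans <| puncturedModelTHomeomorph.trans <|
    (GluckDatum.puncturedProdHomeomorph' _).trans <|
      GluckDatum.puncturedProdHomeomorphEuclidean.trans (GluckDatum.puncturedEuclideanHomeomorph 4)

end Models

/-! ### Homology of the pieces (universe `0`) -/

section Homology

variable {T : Type} [TopologicalSpace T] [T2Space T] [ChartedSpace (𝔼 4) T] {c : 𝕊 1 → T}
  {X : Type} [TopologicalSpace X] (G : CircleSurgeryDatum c X)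

namespace CircleSurgeryDatum

/-- The piece `U₁ = jA(T ∖ c)` seen inside `W`. [folklore] -/
abbrev U₁ : Set ↥G.pieceW := Subtype.val ⁻¹' range G.jA

/-- The piece `V₁ = jB(D̊² × (𝕊² ∖ {s}))` seen inside `W`. [folklore] -/
abbrev V₁ : Set ↥G.pieceW := Subtype.val ⁻¹' G.pieceB Dplus

/-- `W = U₁ ∪ V₁` is an open cover. [folklore] -/
theorem interior_U₁_union_interior_V₁ : interior G.U₁ ∪ interior G.V₁ = univ := by
  rw [(G.hAo.preimage continuous_subtype_val).interior_eq,
    ((G.isOpen_pieceB isOpen_compl_singleton).preimage continuous_subtype_val).interior_eq]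
  refine eq_univ_of_forall fun y => ?_
  exact y.2

/-- `T ∖ c ≃ₜ U₁` via `jA`. [folklore] -/
def homeomorphU₁ : ↥G.ν.complement ≃ₜ ↥G.U₁ :=
  G.hA.toHomeomorph.trans <|
    (Homeomorph.setCongr (inter_eq_right.2 subset_union_left :
        G.pieceW ∩ range G.jA = range G.jA).symm).trans
      (Literature.AlgebraicTopology.SingularHomology.preimageValHomeomorph G.pieceW (range G.jA)).symm

/-- `D̊² × (𝕊² ∖ {s}) ≃ₜ V₁` via `jB`. [folklore] -/
def homeomorphV₁ : ↥{b : ↥discTimesSphere | ((b : (𝔼 2) × (𝕊 2)).2) ∈ (Dplus : Set (𝕊 2))} ≃ₜ ↥G.V₁ :=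
  (G.hB.homeomorphImage _).trans <|
    (Homeomorph.setCongr (inter_eq_right.2 subset_union_right :
        G.pieceW ∩ G.pieceB Dplus = G.pieceB Dplus).symm).trans
      (Literature.AlgebraicTopology.SingularHomology.preimageValHomeomorph G.pieceW (G.pieceB Dplus)).symm

/-- `V₁ ≅ D̊² × (𝕊² ∖ {s})` is contractible. [folklore] -/
instance : ContractibleSpace ↥G.V₁ := G.homeomorphV₁.symm.contractibleSpace

/-- The model embedding `S₊ → X`, `b ↦ jA (ν b) = jB b`. [folklore] -/
theorem isEmbedding_jA_toComplement :
    IsEmbedding (fun b : ↥modelS => G.jA (G.toComplement b.1)) := by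
  have h : (fun b : ↥modelS => G.jA (G.toComplement b.1)) = fun b : ↥modelS => G.jB b.1.1 :=
    funext fun b => G.jA_toComplement b.1
  rw [h]
  exact G.hB.comp (IsEmbedding.subtypeVal.comp IsEmbedding.subtypeVal)

/-- `S₊ ≃ₜ U₁ ∩ V₁` via `b ↦ jA (ν b)`. [folklore] -/
def homeomorphU₁V₁ : ↥modelS ≃ₜ ↥(G.U₁ ∩ G.V₁) :=
  G.isEmbedding_jA_toComplement.toHomeomorph.trans <|
    (Homeomorph.setCongr G.range_jA_inter_pieceB.symm).trans <|
      (Homeomorph.setCongr (inter_eq_right.2 (inter_subset_left.trans subset_union_left) :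
          G.pieceW ∩ (range G.jA ∩ G.pieceB Dplus) = range G.jA ∩ G.pieceB Dplus).symm).trans
        (Literature.AlgebraicTopology.SingularHomology.preimageValHomeomorph G.pieceW (range G.jA ∩ G.pieceB Dplus)).symm

/-- The model of the inclusion `U₁ ∩ V₁ ↪ U₁`: `S₊ ⊂ (D̊² ∖ 0) × 𝕊² → T ∖ c`, `b ↦ ν.glue⁻¹ b`.
[folklore] -/
def modelInclusion : C(↥modelS, ↥G.ν.complement) :=
  G.toComplement.comp ⟨Subtype.val, continuous_subtype_val⟩

/-- The inclusion `U₁ ∩ V₁ ↪ U₁` is conjugate, through the homeomorphisms `homeomorphU₁V₁` and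
`homeomorphU₁`, to the model inclusion `S₊ → T ∖ c`. [folklore] -/
theorem subsetInclusion_homeomorphU₁V₁ (x : ↥modelS) :
    Literature.AlgebraicTopology.SingularHomology.subsetInclusion (inter_subset_left : G.U₁ ∩ G.V₁ ⊆ G.U₁) (G.homeomorphU₁V₁ x) =
      G.homeomorphU₁ (G.modelInclusion x) := rfl

/-- **The homotopy from the core to the gluing region, seen from the base.** For a continuous
`q : T → Y`, the map `[0, 1] × S₊ → Y`, `(σ, (z, v)) ↦ q (ν (z / ‖z‖, σ‖z‖ • v))`: at `σ = 1` it is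
`q` on the gluing region `ν.glue⁻¹(S₊) ⊆ T ∖ c`, at `σ = 0` it is `q ∘ c` of the angular
coordinate `z / ‖z‖` (the tube retracts onto its core circle inside `T`). [folklore] -/
def coreHomotopy {Y : Type} [TopologicalSpace Y] (q : C(T, Y)) (e : C(𝕊 1, Y))
    (hqe : ∀ u, q (c u) = e u) :
    ContinuousMap.Homotopy (e.comp modelSHomotopyEquiv.toFun)
      ((q.comp ⟨Subtype.val, continuous_subtype_val⟩).comp G.modelInclusion) where
  toFun p := q (G.ν.toFun (radialProjection (spherePt 1) ((p.2.1.1 : (𝔼 2) × (𝕊 2)).1),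
    ((p.1 : ℝ) * ‖((p.2.1.1 : (𝔼 2) × (𝕊 2)).1)‖) • (((p.2.1.1 : (𝔼 2) × (𝕊 2)).2 : 𝕊 2) : 𝔼 3)))
  continuous_toFun := by
    refine q.continuous.comp (G.ν.continuous.comp (Continuous.prodMk ?_ ?_))
    · exact (continuousOn_radialProjection _).comp_continuous (by fun_prop) fun p => p.2.1.2
    · fun_prop
  map_zero_left b := by
    have h0 : ((0 : unitInterval) : ℝ) = 0 := rfl
    simp only [h0, zero_mul, zero_smul, G.ν.apply_zero, hqe]
    rfl
  map_one_left b := by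
    have h1 : ((1 : unitInterval) : ℝ) = 1 := rfl
    simp only [h1, one_mul, ContinuousMap.comp_apply, ContinuousMap.coe_mk]
    rw [modelInclusion, ContinuousMap.comp_apply, ContinuousMap.coe_mk, coe_toComplement_apply]
    rfl

/-- **`H₁` of the gluing region injects into `H₁(T ∖ c)` when the circle is dual to a map to the
circle.** If `q : T → Y` restricts along `c` to a homeomorphism `e : 𝕊¹ ≃ₜ Y`, then the model
inclusion `S₊ → T ∖ c` is a monomorphism on `H₁(−; ℤ)`: followed by `q` it is homotopic
(`coreHomotopy`) to the homotopy equivalence `S₊ ≃ 𝕊¹ ≅ Y`. [folklore] -/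
theorem mono_map_modelInclusion_one {Y : Type} [TopologicalSpace Y] (q : C(T, Y)) (e : 𝕊 1 ≃ₜ Y)
    (hqe : ∀ u, q (c u) = e u) : Mono (Literature.AlgebraicTopology.SingularHomology.singularHomology.map ℤ ℤ G.modelInclusion 1) := by
  set E : ContinuousMap.HomotopyEquiv ↥modelS Y :=
    modelSHomotopyEquiv.trans e.toHomotopyEquiv with hE
  have hEfun : E.toFun = (e : C(𝕊 1, Y)).comp modelSHomotopyEquiv.toFun := rfl
  have hhom : ((q.comp ⟨Subtype.val, continuous_subtype_val⟩).comp G.modelInclusion).Homotopic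
      E.toFun := by
    rw [hEfun]
    exact ⟨(G.coreHomotopy q (e : C(𝕊 1, Y)) hqe).symm⟩
  haveI : Mono (Literature.AlgebraicTopology.SingularHomology.singularHomology.map ℤ ℤ E.toFun 1) := by
    rw [← Literature.AlgebraicTopology.SingularHomology.singularHomology.isoOfHomotopyEquiv_hom]
    infer_instance
  have hfac : Literature.AlgebraicTopology.SingularHomology.singularHomology.map ℤ ℤ G.modelInclusion 1 ≫
      Literature.AlgebraicTopology.SingularHomology.singularHomology.map ℤ ℤ (q.comp ⟨Subtype.val, continuous_subtype_val⟩) 1 =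
        Literature.AlgebraicTopology.SingularHomology.singularHomology.map ℤ ℤ E.toFun 1 := by
    rw [← Literature.AlgebraicTopology.SingularHomology.singularHomology.map_comp, Literature.AlgebraicTopology.SingularHomology.singularHomology.map_eq_of_homotopic ℤ ℤ hhom]
  exact mono_of_mono_fac hfac

/-- **Step 1: `H₂(W; ℤ) = 0`** for `W = jA(T ∖ c) ∪ jB(D̊² × (𝕊² ∖ {s}))`, by Mayer–Vietoris
(`mayerVietoris.isZero_of_mono_inter`): `H₂(T ∖ c) = 0` (hypothesis `hT`), `D̊² × (𝕊² ∖ {s})` is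
contractible, and `H₁(U₁ ∩ V₁) → H₁(U₁)` is injective, being modelled on `S₊ → T ∖ c`
(`mono_map_modelInclusion_one`, which needs the map `q : T → Y` restricting to a homeomorphism
`𝕊¹ ≃ₜ Y` along `c`). The excision and exactness facts of `ExcisionMayerVietoris.lean` are
hypotheses. [cite: HatcherAT2002, §2.2 p. 149] -/
theorem isZero_singularHomology_pieceW_two
    (hexcW : Literature.AlgebraicTopology.SingularHomology.relativeSingularHomology.isIso_map_of_interior_union_interior ℤ ℤ ↥G.pieceW)
    (h₂ : Literature.AlgebraicTopology.SingularHomology.mayerVietoris.exact₂ ℤ ℤ G.U₁ G.V₁)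
    (hT : IsZero (Literature.AlgebraicTopology.SingularHomology.singularHomology ℤ ℤ ↥G.ν.complement 2))
    {Y : Type} [TopologicalSpace Y] (q : C(T, Y)) (e : 𝕊 1 ≃ₜ Y) (hqe : ∀ u, q (c u) = e u) :
    IsZero (Literature.AlgebraicTopology.SingularHomology.singularHomology ℤ ℤ ↥G.pieceW 2) := by
  refine mayerVietoris.isZero_of_mono_inter ℤ ℤ G.U₁ G.V₁ hexcW h₂
    G.interior_U₁_union_interior_V₁ 1
    (hT.of_iso (Literature.AlgebraicTopology.SingularHomology.singularHomology.mapIso ℤ ℤ G.homeomorphU₁ 2).symm)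
    (Literature.AlgebraicTopology.SingularHomology.isZero_singularHomology_of_contractibleSpace ℤ ℤ two_ne_zero) ?_
  refine Literature.AlgebraicTopology.SingularHomology.singularHomology.mono_map_of_conj ℤ ℤ _ G.modelInclusion G.homeomorphU₁V₁ G.homeomorphU₁
    G.subsetInclusion_homeomorphU₁V₁ 1 ?_
  exact G.mono_map_modelInclusion_one q e hqe

/-- `D̊² × (𝕊² ∖ {n}) ≃ₜ V₋ = jB(D̊² × (𝕊² ∖ {n}))`. [folklore] -/
def homeomorphVminus :
    ↥{b : ↥discTimesSphere | ((b : (𝔼 2) × (𝕊 2)).2) ∈ (Dminus : Set (𝕊 2))} ≃ₜ ↥(G.pieceB Dminus) :=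
  G.hB.homeomorphImage _

/-- `V₋ ≅ D̊² × (𝕊² ∖ {n})` is contractible. [folklore] -/
instance : ContractibleSpace ↥(G.pieceB Dminus) := G.homeomorphVminus.symm.contractibleSpace

/-- **`H₁(W ∩ V₋; ℤ) = 0`**: `W ∩ V₋ = jB(T) ≅ T ≅ ℝ⁴ ∖ {pt} ≃ S³` (`modelTHomeomorphPunctured`,
radial retraction `Literature.AlgebraicTopology.SingularHomology.sphereHomotopyEquivPunctured`) and `H₁(S³) = 0`
(`isZero_singularHomology_sphere`, Hatcher Cor. 2.14). [cite: HatcherAT2002, Cor. 2.14] -/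
theorem isZero_singularHomology_pieceW_inter_one (hS : Literature.AlgebraicTopology.SingularHomology.isZero_singularHomology_sphere ℤ ℤ) :
    IsZero (Literature.AlgebraicTopology.SingularHomology.singularHomology ℤ ℤ ↥(G.pieceW ∩ G.pieceB Dminus) 1) := by
  have e : ↥(G.pieceW ∩ G.pieceB Dminus) ≃ₜ ↥(Literature.AlgebraicTopology.SingularHomology.punctured 4) :=
    (Homeomorph.setCongr G.pieceW_inter_pieceB).trans <|
      (G.hB.homeomorphImage modelT).symm.trans modelTHomeomorphPunctured
  exact (hS (n := 3) (k := 1) one_ne_zero (by norm_num)).of_iso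
    ((Literature.AlgebraicTopology.SingularHomology.singularHomology.mapIso ℤ ℤ e 1).trans
      (Literature.AlgebraicTopology.SingularHomology.singularHomology.isoOfHomotopyEquiv ℤ ℤ (Literature.AlgebraicTopology.SingularHomology.sphereHomotopyEquivPunctured 4).symm 1))

/-- **Step 2: `H₂(X; ℤ) = 0`** by Mayer–Vietoris for `X = W ∪ V₋`: `H₂(W) = 0` (step 1),
`V₋ ≅ D̊² × (𝕊² ∖ {n})` is contractible and `H₁(W ∩ V₋) = H₁(S³) = 0`.
[cite: HatcherAT2002, §2.2 p. 149] -/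
theorem isZero_singularHomology_two
    (hexcX : Literature.AlgebraicTopology.SingularHomology.relativeSingularHomology.isIso_map_of_interior_union_interior ℤ ℤ X)
    (h₂ : Literature.AlgebraicTopology.SingularHomology.mayerVietoris.exact₂ ℤ ℤ G.pieceW (G.pieceB Dminus))
    (hS : Literature.AlgebraicTopology.SingularHomology.isZero_singularHomology_sphere ℤ ℤ)
    (hW : IsZero (Literature.AlgebraicTopology.SingularHomology.singularHomology ℤ ℤ ↥G.pieceW 2)) :
    IsZero (Literature.AlgebraicTopology.SingularHomology.singularHomology ℤ ℤ X 2) := by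
  have hcov : interior G.pieceW ∪ interior (G.pieceB Dminus) = univ := by
    rw [G.isOpen_pieceW.interior_eq, (G.isOpen_pieceB isOpen_compl_singleton).interior_eq]
    exact G.pieceW_union_pieceB
  exact mayerVietoris.isZero_of_isZero_inter ℤ ℤ G.pieceW (G.pieceB Dminus) hexcX h₂ hcov 1 hW
    (Literature.AlgebraicTopology.SingularHomology.isZero_singularHomology_of_contractibleSpace ℤ ℤ two_ne_zero)
    (G.isZero_singularHomology_pieceW_inter_one hS)

/-- **`H₂ = 0` after surgery on a circle dual to a map to the circle** (both steps): if `X` is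
obtained from `T` by surgery on `c` (`CircleSurgeryDatum`), `H₂(T ∖ c; ℤ) = 0`, and some
continuous `q : T → Y` restricts along `c` to a homeomorphism `𝕊¹ ≃ₜ Y`, then `H₂(X; ℤ) = 0`,
granted excision, Mayer–Vietoris exactness and the homology of spheres (named facts of
`ExcisionMayerVietoris.lean`, hypotheses). This is the homological content of "the surgery
creates no 2-homology since the meridian sphere bounds the punctured fibre" (Gompf, Algebr. Geom.
Topol. 10 (2010), §2, proof of Thm. 2.1) in the form used here. [cite: GompfAGT2010, §2, proof of Thm. 2.1] -/
theorem isZero_singularHomology_two_of_facts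
    (hexc : ∀ (S : Type) [TopologicalSpace S],
      Literature.AlgebraicTopology.SingularHomology.relativeSingularHomology.isIso_map_of_interior_union_interior ℤ ℤ S)
    (h₂ : ∀ (S : Type) [TopologicalSpace S] (U V : Set S), Literature.AlgebraicTopology.SingularHomology.mayerVietoris.exact₂ ℤ ℤ U V)
    (hS : Literature.AlgebraicTopology.SingularHomology.isZero_singularHomology_sphere ℤ ℤ)
    (hT : IsZero (Literature.AlgebraicTopology.SingularHomology.singularHomology ℤ ℤ ↥G.ν.complement 2))
    {Y : Type} [TopologicalSpace Y] (q : C(T, Y)) (e : 𝕊 1 ≃ₜ Y) (hqe : ∀ u, q (c u) = e u) :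
    IsZero (Literature.AlgebraicTopology.SingularHomology.singularHomology ℤ ℤ X 2) :=
  G.isZero_singularHomology_two (hexc X) (h₂ X _ _) hS
    (G.isZero_singularHomology_pieceW_two (hexc _) (h₂ _ _ _) hT q e hqe)

end CircleSurgeryDatum

end Homology

end Literature.Topology.FourManifolds


namespace Literature.Topology.FourManifolds

/-- Local notation: `𝔼 n` is the model Euclidean space `EuclideanSpace ℝ (Fin n)`. -/
local notation "𝔼 " n:arg => EuclideanSpace ℝ (Fin n)

/-- Local notation: `𝕊 n` is the unit sphere in `EuclideanSpace ℝ (Fin (n + 1))`. -/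
local notation "𝕊 " n:arg => (Metric.sphere (0 : EuclideanSpace ℝ (Fin (n + 1))) 1)

/-- Local notation: the model with corners `𝓣 = (𝓡 1).prod ((𝓡 1).prod (𝓡 1))` of `ThreeTorus`. -/
local notation "𝓣" =>
  (ModelWithCorners.prod (𝓡 1) (ModelWithCorners.prod (𝓡 1) (𝓡 1)))

/-! ### Cappell–Shaneson spheres: the named fact `H₂(T_A ∖ C) = 0` and the assembled leaf -/

section CappellShaneson

/-- **`H₂(T_A ∖ C; ℤ) = 0` for a Cappell–Shaneson mapping torus** (named fact, not proved here).
For `A ∈ SL(3, ℤ)` with `det (A - 1) = ±1`, a smooth mapping torus `T` of the linear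
diffeomorphism `torusDiffeomorph A` of `T³` — glued from `T³ × (0, 1)` and `T³ × (1/2, 3/2)` by
open embeddings `jA`, `jB` along `mappingTorusRel (torusDiffeomorph A)`, exactly the data of
`Literature.Topology.FourManifolds.IsCappellShanesonSphereOf` — and the section circle `c` through the fixed point `1 ∈ T³`
(`range c = jA({1} × (0, 1)) ∪ jB({1} × (1/2, 3/2))`), the complement `T ∖ c(𝕊¹)` has vanishing
second singular homology with integer coefficients. Mechanism (Cappell–Shaneson, Ann. of Math. 104
(1976), §2: `T_A` is a homology `S¹ × S³` and the circle complement a homology circle when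
`det (A - 1) = ±1`): `T ∖ c` is the mapping torus of `A` acting on `T³ ∖ {1}`, whose homology is
`H₁ = ℤ³` (action `A`) and `H₂ = ℤ³ = Λ²ℤ³` (action `Λ²A = (A⁻¹)ᵀ`), `H₃ = 0`; in the Wang sequence
`H₂(T³ ∖ 1) →(Λ²A - 1) H₂(T³ ∖ 1) → H₂(T ∖ c) → H₁(T³ ∖ 1) →(A - 1) H₁(T³ ∖ 1)` both outer maps
are isomorphisms since `det (A - 1) = ±1` and `det (A⁻¹ - 1) = -det (A - 1)`
(`Literature.Topology.FourManifolds.det_coe_inv_sub_one_fin_three`), so `H₂(T ∖ c) = 0`. Stated at universe `0`, where the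
mapping tori of `IsCappellShanesonSphereOf` live (Cappell–Shaneson 1976, §2; Gompf, Topology Appl.
38 (1991), §2; Hatcher, *Algebraic Topology*, Ex. 2.48 for the Wang/Mayer–Vietoris sequence of a
mapping torus). [cite: CappellShanesonAnnals1976, §2] -/
def isZero_singularHomology_two_mappingTorus_compl_sectionCircle : Prop :=
  ∀ (A : Matrix.SpecialLinearGroup (Fin 3) ℤ) (_ : (A.1 - 1).det = 1 ∨ (A.1 - 1).det = -1)
    (T : Type) [TopologicalSpace T] [T2Space T] [SecondCountableTopology T] [CompactSpace T]
    [ChartedSpace (𝔼 4) T] [IsManifold (𝓡 4) ∞ T]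
    (jA : ThreeTorus × ↥mappingTorusPieceOne → T) (jB : ThreeTorus × ↥mappingTorusPieceTwo → T)
    (_ : IsOpenGluingWith (ModelWithCorners.prod 𝓣 𝓘(ℝ, ℝ)) (ModelWithCorners.prod 𝓣 𝓘(ℝ, ℝ))
      (𝓡 4) (mappingTorusRel ⇑(torusDiffeomorph A)) jA jB)
    (c : 𝕊 1 → T) (_ : Manifold.IsSmoothEmbedding (𝓡 1) (𝓡 4) ∞ c)
    (_ : range c = jA '' ({1} ×ˢ univ) ∪ jB '' ({1} ×ˢ univ)),
    IsZero (Literature.AlgebraicTopology.SingularHomology.singularHomology ℤ ℤ ↥((range c)ᶜ : Set T) 2)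

/-- **Cappell–Shaneson 1976, §2: `H₂(X; ℤ) = 0` for a Cappell–Shaneson sphere `X` of `A`, from
Mayer–Vietoris** (universe `0`). Granted excision and Mayer–Vietoris exactness for singular
homology and the homology of spheres (named facts of `ExcisionMayerVietoris.lean`; Hatcher Thm.
2.20, §2.2, Cor. 2.14) and `H₂(T_A ∖ C) = 0`
(`isZero_singularHomology_two_mappingTorus_compl_sectionCircle`), every Cappell–Shaneson sphere
`X : Type` of `A` has `H₂(X; ℤ) = 0`. Proof: `X` is a circle surgery on the section circle `c` of
the mapping torus `T` (`CircleSurgeryDatum`); the bundle projection `T → ℝ / ℤ`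
(`exists_bundleProjection`) restricts along `c` to a homeomorphism `𝕊¹ ≃ₜ ℝ / ℤ`
(`exists_homeomorph_bundleProjection_comp`, the monodromy fixes `1 ∈ T³`); conclude by
`CircleSurgeryDatum.isZero_singularHomology_two_of_facts`. [cite: CappellShanesonAnnals1976, §2] -/
theorem IsCappellShanesonSphereOf.isZero_singularHomology_two_of_mayerVietoris
    (hexc : ∀ (S : Type) [TopologicalSpace S],
      Literature.AlgebraicTopology.SingularHomology.relativeSingularHomology.isIso_map_of_interior_union_interior ℤ ℤ S)
    (h₂ : ∀ (S : Type) [TopologicalSpace S] (U V : Set S), Literature.AlgebraicTopology.SingularHomology.mayerVietoris.exact₂ ℤ ℤ U V)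
    (hS : Literature.AlgebraicTopology.SingularHomology.isZero_singularHomology_sphere ℤ ℤ)
    (hL : isZero_singularHomology_two_mappingTorus_compl_sectionCircle)
    {A : Matrix.SpecialLinearGroup (Fin 3) ℤ} {X : Type} [TopologicalSpace X]
    [ChartedSpace (𝔼 4) X] (h : IsCappellShanesonSphereOf A X) :
    IsZero (Literature.AlgebraicTopology.SingularHomology.singularHomology ℤ ℤ X 2) := by
  obtain ⟨hdet, T, _, _, _, _, _, _, jA, jB, hT, c, hc, hrange, hX⟩ := h
  obtain ⟨G⟩ := hX.nonempty_circleSurgeryDatum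
  have hL' : IsZero (Literature.AlgebraicTopology.SingularHomology.singularHomology ℤ ℤ ↥G.ν.complement 2) := hL A hdet T jA jB hT c hc hrange
  obtain ⟨hAe, hAo, hBe, hBo, hU, hR⟩ := hT
  obtain ⟨p, hpA, hpB⟩ :=
    exists_bundleProjection ⟨hAe.isEmbedding, hAo⟩ ⟨hBe.isEmbedding, hBo⟩ hU hR
  obtain ⟨e, he⟩ := exists_homeomorph_bundleProjection_comp hR p hpA hpB
    (torusDiffeomorph_apply_one A) hc.isEmbedding.continuous hc.isEmbedding.injective hrange
  exact G.isZero_singularHomology_two_of_facts hexc h₂ hS hL' p e fun u => (he u).symm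

/-- **Cappell–Shaneson 1976, §2: `H₂(X; ℤ) = 0` for every Cappell–Shaneson sphere `X : Type`**,
from Mayer–Vietoris and `H₂(T_A ∖ C) = 0` (see
`IsCappellShanesonSphereOf.isZero_singularHomology_two_of_mayerVietoris`). [cite: CappellShanesonAnnals1976, §2] -/
theorem IsCappellShanesonSphere.isZero_singularHomology_two_of_mayerVietoris
    (hexc : ∀ (S : Type) [TopologicalSpace S],
      Literature.AlgebraicTopology.SingularHomology.relativeSingularHomology.isIso_map_of_interior_union_interior ℤ ℤ S)
    (h₂ : ∀ (S : Type) [TopologicalSpace S] (U V : Set S), Literature.AlgebraicTopology.SingularHomology.mayerVietoris.exact₂ ℤ ℤ U V)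
    (hS : Literature.AlgebraicTopology.SingularHomology.isZero_singularHomology_sphere ℤ ℤ)
    (hL : isZero_singularHomology_two_mappingTorus_compl_sectionCircle)
    {X : Type} [TopologicalSpace X] [ChartedSpace (𝔼 4) X] (h : IsCappellShanesonSphere X) :
    IsZero (Literature.AlgebraicTopology.SingularHomology.singularHomology ℤ ℤ X 2) := by
  obtain ⟨A, hA⟩ := h
  exact hA.isZero_singularHomology_two_of_mayerVietoris hexc h₂ hS hL

end CappellShaneson

end Literature.Topology.FourManifolds
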